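import Literature.AlgebraicGeometry.ComplexMultiplication.CyclotomicFermatCMTypesKoblitzListTwoOddPrimes
import Literature.AlgebraicGeometry.ComplexMultiplication.CyclotomicFermatCMTypesKoblitzListPrimeFamilies
import HarnessLib

/-!
# Koblitz's list at the levels `pᵃ·qᵇ` for EVERY pair of distinct primes `p, q ≡ 3 (mod 4)`: NO primitive group triple unless `{p, q} = {3, 7}`

Layer `Literature/AlgebraicGeometry/ComplexMultiplication`, namespace `…ComplexMultiplication.CyclotomicFermatCMType`; sequel of
`…KoblitzListTwoOddPrimes` (gen 43: at `N = pᵐ⁺¹qⁿ⁺¹`, `p ≠ q` primes `≡ 3 (mod 4)` with `(q/p) = +1`, NO primitive normalised triple has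
`H_{r,s,t}` a group as soon as `4p·|B_{1,χ_q}| < (p−1)(q−1)`; instances `{7,11}, {7,19}, {11,19}, {7,23}, {11,23}`) and `…KoblitzListPrimeFamilies`
(this lane gen 44: `6·|B_{1,χ_q}| < q − 1` for `q ≥ 121` from `|B_{1,χ_q}| ≤ π⁻¹√q·log q`, Euler-criterion kernel certificates, and the family
`3ᵃ·pᵇ` for every `p ≡ 3 (mod 4)`, `p ∉ {3, 7}`).  THEOREMS ONLY (no definition, no named fact, no `sorry`).

SOURCE.  M. Bauer, A. Coste, C. Itzykson, P. Ruelle, *J. Geom. Phys.* **22** (1997) §3.4 p. 14 (held: `paper:arxiv-hep-th_9604104`): Koblitz's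
list `{3, 4, 6, 7, 8, 12, 15, 16, 18, 20, 21, 22, 24, 30, 39, 40, 48, 60}` [kob] ([kob] = N. Koblitz, Duke Math. J. **45** (1978) 87–99, NOT held,
acq-13447; the proofs here are ours).  N. Koblitz, D. Rohrlich, *Canad. J. Math.* **30** (1978) §2 p. 1187.  K. Ireland, M. Rosen, GTM 84 (1982),
Ch. 5 §1 Prop. 5.1.2 (a) (Euler's criterion), §2 Thm. 1 (quadratic reciprocity).

THE POINT.  The class-number hypothesis of gen 43's conditional theorem holds for EVERY admissible pair: by reciprocity exactly one of `(q/p)`,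
`(p/q)` is `+1`, say `(q/p) = +1`; then `4p·|B_{1,χ_q}| < (p−1)(q−1)` because **`|B_{1,χ_q}| = h(−q)` is SMALL**: for `q ≥ 121` the analytic
bound gives `6·|B_{1,χ_q}| < q − 1` and `4p/6 ≤ p − 1` (`p ≥ 3`); for `7 ≤ q < 121` ONE kernel certificate (Euler's criterion, `decide +kernel`)
gives `14·h(−q) < 3(q − 1)` for the fourteen primes `q ≡ 3 (mod 4)` there, and `6p/7 ≤ p − 1` (`p ≥ 7`).  The pairs containing `3` are the family
`3ᵃ·pᵇ` of the prequel (none unless `p = 7`: the printed level `21 = 3·7`).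

## What is proved (namespace `…CyclotomicFermatCMType`)

* §1 **`seven_mul_natAbs_sum_lt_of_mem`** (kernel certificate `7·|S_q| < 3q(q−1)` for `q ∈ {7, 11, 19, 23, 31, 43, 47, 59, 67, 71, 79, 83, 103,
  107}`), coverage `mem_or_exists_dvd_of_lt_121_mod_four`, **`fourteen_mul_norm_bernoulliOneChar_lt_of_lt`** (`14·|B_{1,χ_q}| < 3(q − 1)` for
  every prime `q ≡ 3 (mod 4)`, `7 ≤ q < 121`).
* §2 **`four_mul_mul_norm_bernoulliOneChar_lt`** — **`4p·|B_{1,χ_q}| < (p−1)(q−1)` for every prime `q ≡ 3 (mod 4)`, `q ≥ 7`, and every `p ≥ 7`.**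
* §3 **`isSquare_or_isSquare_of_mod_four`** (reciprocity: `(q/p) = +1` or `(p/q) = +1`), **`not_forall_mul_mem_two_primes_of_isSquare`**
  (`p, q ≥ 7`, `(q/p) = +1`: no primitive group triple at `pᵐ⁺¹qⁿ⁺¹`), and the headline **`not_forall_mul_mem_two_primes`**: **for EVERY pair of
  distinct primes `p, q ≡ 3 (mod 4)` with `{p, q} ≠ {3, 7}`, NO primitive normalised triple at any level `pᵐ⁺¹·qⁿ⁺¹` has `H_{r,s,t}` a group.**

## Honest column / NOT here

* Pairs with a prime `≡ 1 (mod 4)` (printed `15 = 3·5`, `39 = 3·13`) are not touched (`χ_p` even; `χ_pχ_q` has a non-constant `B₁`), nor three or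
  more odd primes, nor `8·pᵏ`.  The printed list itself remains CITE [kob] beyond the settled families.  `J(F_n)` is not constructed.  HC_CM is
  NOT proved and nothing here bears on it.

## References

* [BauerCosteItzyksonRuelle1997] M. Bauer, A. Coste, C. Itzykson, P. Ruelle, J. Geom. Phys. 22 (1997) 134–189, §3.4 (p. 14).
* [KoblitzRohrlich1978] N. Koblitz, D. Rohrlich, Canad. J. Math. 30 (1978) 1183–1205, §2 (p. 1187).
* [IrelandRosen1982] K. Ireland, M. Rosen, A Classical Introduction to Modern Number Theory, GTM 84, Springer 1982, Ch. 5 §1 Prop. 5.1.2, §2 Thm. 1.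
* [LangCyclotomic1990] S. Lang, Cyclotomic Fields I and II, GTM 121, Springer 1990, Ch. 2 §1.
* [kob] N. Koblitz, Duke Math. J. 45 (1978) 87–99 — cited for the statement of the list only; not held, not used.

## Provenance

Cell `pub-hodgecm2` (COR-CM), literature seat `lit-deligne-3` gen 44 (claim KOBLITZ-TWO-ODD-PRIMES-ALL; count-neutral, own lane).  HC_CM is NOT
proved and nothing here bears on it.
-/

noncomputable section

open NumberField

namespace Literature.AlgebraicGeometry.ComplexMultiplication

open Literature.NumberTheory.LFunctions
open Literature.AlgebraicGeometry.HodgeTheory (fermatCMType)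

namespace CyclotomicFermatCMType

/-! ## §1 Kernel certificate `14·h(−q) < 3(q − 1)` for the primes `q ≡ 3 (mod 4)`, `7 ≤ q < 121` -/

section Certificate

variable {q : ℕ} [hq : Fact q.Prime]

/-- **KERNEL CERTIFICATE: `7·|S_q| < 3q(q − 1)`, i.e. `14·h(−q) < 3(q − 1)`, for the fourteen primes `q ≡ 3 (mod 4)`, `7 ≤ q ≤ 107`**
(`h(−q) = |S_q|/(2q)`, `S_q = Σ_{a<q} ε_q(a)(2a − q)`, `ε_q` by Euler's criterion; one `decide`). [cite: BauerCosteItzyksonRuelle1997, §3.4]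
[cite: IrelandRosen1982, Ch. 5 §1 Prop. 5.1.2 (a)] -/
theorem seven_mul_natAbs_sum_lt_of_mem : ∀ q ∈ ([7, 11, 19, 23, 31, 43, 47, 59, 67, 71, 79, 83, 103, 107] : List ℕ),
    7 * (∑ a ∈ Finset.range q, (if a % q = 0 then (0 : ℤ) else if a ^ (q / 2) % q = 1 then 1 else -1) * (2 * (a : ℤ) - q)).natAbs
      < 3 * q * (q - 1) := by
  decide +kernel

/-- Coverage: every `q ≡ 3 (mod 4)` with `7 ≤ q < 121` is one of the fourteen listed primes or has a proper divisor in `{3, 5, 7}`.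
[cite: BauerCosteItzyksonRuelle1997, §3.4] -/
theorem mem_or_exists_dvd_of_lt_121_mod_four : ∀ q ∈ Finset.range 121, 7 ≤ q → q % 4 = 3 →
    q ∈ ([7, 11, 19, 23, 31, 43, 47, 59, 67, 71, 79, 83, 103, 107] : List ℕ) ∨ ∃ d ∈ ([3, 5, 7] : List ℕ), d ∣ q ∧ d < q := by
  decide +kernel

/-- A prime has no proper divisor `2 ≤ d < q`, `d ∣ q`, from a list. [folklore] -/
private theorem not_exists_dvd_lt_of_prime {l : List ℕ} (hl : ∀ d ∈ l, 2 ≤ d) : ¬∃ d ∈ l, d ∣ q ∧ d < q := by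
  rintro ⟨d, hd, hdq, hlt⟩
  rcases hq.out.eq_one_or_self_of_dvd d hdq with h | h <;> have := hl d hd <;> omega

/-- Casting a certificate `c·A < k·q·(q − 1)` to `C·(A/(2q)) < K·(q − 1)` over `ℝ` (`C = 2c`, `K = k`). [folklore] -/
private theorem cast_mul_div_lt_mul {c k A : ℕ} (hc : c * A < k * q * (q - 1)) {C K : ℝ} (hC : C = 2 * c) (hK : K = k) :
    C * ((A : ℝ) / (2 * (q : ℝ))) < K * ((q : ℝ) - 1) := by
  have hq0 : (0 : ℝ) < q := by exact_mod_cast hq.out.pos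
  rw [hC, hK, show 2 * (c : ℝ) * ((A : ℝ) / (2 * (q : ℝ))) = (c : ℝ) * A / q by field_simp, div_lt_iff₀ hq0]
  have h2 : ((c * A : ℕ) : ℝ) < ((k * q * (q - 1) : ℕ) : ℝ) := by exact_mod_cast hc
  push_cast [Nat.cast_sub hq.out.one_le] at h2
  linarith

/-- **`14·|B_{1,χ_q}| < 3(q − 1)` for every prime `q ≡ 3 (mod 4)` with `7 ≤ q < 121`** (kernel certificate). [cite: BauerCosteItzyksonRuelle1997, §3.4]
[cite: LangCyclotomic1990, Ch. 2 §1] -/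
theorem fourteen_mul_norm_bernoulliOneChar_lt_of_lt (hq4 : q % 4 = 3) (h7 : 7 ≤ q) (h121 : q < 121) :
    14 * ‖bernoulliOneChar ((quadraticChar (ZMod q)).ringHomComp (Int.castRingHom ℂ))‖ < 3 * ((q : ℝ) - 1) := by
  have hmem := (mem_or_exists_dvd_of_lt_121_mod_four q (Finset.mem_range.2 h121) h7 hq4).resolve_right
    (not_exists_dvd_lt_of_prime fun d hd => by simp only [List.mem_cons, List.mem_nil_iff, or_false] at hd; omega)
  rw [norm_bernoulliOneChar_quadraticChar_eq_natAbs_div (by omega)]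
  exact cast_mul_div_lt_mul (seven_mul_natAbs_sum_lt_of_mem q hmem) (by norm_num) (by norm_num)

end Certificate

/-! ## §2 `4p·|B_{1,χ_q}| < (p−1)(q−1)` for every `p, q ≥ 7` -/

section Hypothesis

variable {q : ℕ} [hq : Fact q.Prime]

/-- **`4p·|B_{1,χ_q}| < (p − 1)(q − 1)` for every prime `q ≡ 3 (mod 4)`, `q ≥ 7`, and every natural number `p ≥ 7`** (`q ≥ 121`: `6·|B₁| < q − 1`
and `4p ≤ 6(p − 1)`; `q < 121`: `14·|B₁| < 3(q − 1)` and `12p ≤ 14(p − 1)`). [cite: BauerCosteItzyksonRuelle1997, §3.4] [cite: KoblitzRohrlich1978, §2 (p. 1187)] -/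
theorem four_mul_mul_norm_bernoulliOneChar_lt (hq4 : q % 4 = 3) (hq7 : 7 ≤ q) {p : ℕ} (hp7 : 7 ≤ p) :
    4 * (p : ℝ) * ‖bernoulliOneChar ((quadraticChar (ZMod q)).ringHomComp (Int.castRingHom ℂ))‖ < ((p : ℝ) - 1) * ((q : ℝ) - 1) := by
  have hp7' : (7 : ℝ) ≤ p := by exact_mod_cast hp7
  have hq7' : (7 : ℝ) ≤ q := by exact_mod_cast hq7
  have hβ := norm_nonneg (bernoulliOneChar ((quadraticChar (ZMod q)).ringHomComp (Int.castRingHom ℂ)))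
  by_cases h121 : 121 ≤ q
  · have h6 := six_mul_norm_bernoulliOneChar_lt hq4 h121
    nlinarith
  · have h14 := fourteen_mul_norm_bernoulliOneChar_lt_of_lt hq4 hq7 (by omega)
    nlinarith

end Hypothesis

/-! ## §3 Every pair of distinct primes `p, q ≡ 3 (mod 4)` -/

section Pairs

variable {p q m n : ℕ} [hp : Fact p.Prime] [hq : Fact q.Prime] {N : ℕ} [NeZero N]

/-- **Reciprocity for `p ≠ q ≡ 3 (mod 4)`: `(q/p) = +1` or `(p/q) = +1`** (exactly one, by `(q/p) = −(p/q)`; the disjunction is what is used).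
[cite: IrelandRosen1982, Ch. 5 §2 Thm. 1] -/
theorem isSquare_or_isSquare_of_mod_four (hp4 : p % 4 = 3) (hq4 : q % 4 = 3) (hpq : p ≠ q) :
    IsSquare ((q : ℕ) : ZMod p) ∨ IsSquare ((p : ℕ) : ZMod q) := by
  have hq0 : ((q : ℤ) : ZMod p) ≠ 0 := by
    rw [Int.cast_natCast, Ne, ZMod.natCast_eq_zero_iff]
    exact fun h => hpq ((Nat.prime_dvd_prime_iff_eq hp.out hq.out).1 h)
  have hp0 : ((p : ℤ) : ZMod q) ≠ 0 := by
    rw [Int.cast_natCast, Ne, ZMod.natCast_eq_zero_iff]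
    exact fun h => hpq ((Nat.prime_dvd_prime_iff_eq hq.out hp.out).1 h).symm
  have hrec := legendreSym.quadratic_reciprocity_three_mod_four hp4 hq4
  rcases legendreSym.eq_one_or_neg_one p hq0 with h | h
  · exact Or.inl ((legendreSym.eq_one_iff' p (by exact_mod_cast hq0)).1 h)
  · right
    have h1 : legendreSym q p = 1 := by rw [hrec, h]; norm_num
    exact (legendreSym.eq_one_iff' q (by exact_mod_cast hp0)).1 h1

/-- **LEVELS `pᵐ⁺¹·qⁿ⁺¹`, `p ≠ q` primes `≡ 3 (mod 4)`, both `≥ 7`, `(q/p) = +1`: NO primitive normalised triple has `H_{r,s,t}` a group** (the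
prequel's conditional theorem with `4p·|B_{1,χ_q}| < (p−1)(q−1)` discharged). [cite: BauerCosteItzyksonRuelle1997, §3.4] [cite: KoblitzRohrlich1978, §2 (p. 1187)] -/
theorem not_forall_mul_mem_two_primes_of_isSquare (hp4 : p % 4 = 3) (hq4 : q % 4 = 3) (hpq : p ≠ q) (hp7 : 7 ≤ p) (hq7 : 7 ≤ q)
    (hqsq : IsSquare ((q : ℕ) : ZMod p)) (hN : N = p ^ (m + 1) * q ^ (n + 1)) {r s : ZMod N} (hr : r ≠ 0) (hs : s ≠ 0)
    (hrs : r.val + s.val < N) (hprim : Nat.gcd (Nat.gcd r.val s.val) N = 1) :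
    ¬∀ a ∈ fermatCMType N r s (-(r + s)), ∀ b ∈ fermatCMType N r s (-(r + s)), a * b ∈ fermatCMType N r s (-(r + s)) :=
  not_forall_mul_mem_two_primes_of_bernoulli_lt hp4 hq4 hpq hqsq (four_mul_mul_norm_bernoulliOneChar_lt hq4 hq7 hp7) hN hr hs hrs hprim

/-- **LEVELS `pᵐ⁺¹·qⁿ⁺¹` FOR EVERY PAIR OF DISTINCT PRIMES `p, q ≡ 3 (mod 4)` WITH `{p, q} ≠ {3, 7}`: NO primitive normalised triple has
`H_{r,s,t}` a group** (`3 ∈ {p, q}`: the family `3ᵃ·pᵇ`; otherwise reciprocity and the previous theorem, in the orientation with `(q/p) = +1`;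
`21 = 3·7` IS a printed level). [cite: BauerCosteItzyksonRuelle1997, §3.4] [cite: KoblitzRohrlich1978, §2 (p. 1187)] -/
theorem not_forall_mul_mem_two_primes (hp4 : p % 4 = 3) (hq4 : q % 4 = 3) (hpq : p ≠ q) (h37 : ¬(p = 3 ∧ q = 7)) (h73 : ¬(p = 7 ∧ q = 3))
    (hN : N = p ^ (m + 1) * q ^ (n + 1)) {r s : ZMod N} (hr : r ≠ 0) (hs : s ≠ 0) (hrs : r.val + s.val < N)
    (hprim : Nat.gcd (Nat.gcd r.val s.val) N = 1) :
    ¬∀ a ∈ fermatCMType N r s (-(r + s)), ∀ b ∈ fermatCMType N r s (-(r + s)), a * b ∈ fermatCMType N r s (-(r + s)) := by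
  by_cases hp3 : p = 3
  · subst hp3
    exact not_forall_mul_mem_threeTimesPrimePow_of_mod_four (p := q) hq4 (fun h => hpq h.symm) (fun h => h37 ⟨rfl, h⟩) hN hr hs hrs hprim
  by_cases hq3 : q = 3
  · subst hq3
    exact not_forall_mul_mem_threeTimesPrimePow_of_mod_four (p := p) hp4 hpq (fun h => h73 ⟨h, rfl⟩)
      (hN.trans (mul_comm _ _)) hr hs hrs hprim
  have hp7 : 7 ≤ p := by omega
  have hq7 : 7 ≤ q := by omega
  rcases isSquare_or_isSquare_of_mod_four hp4 hq4 hpq with hsq | hsq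
  · exact not_forall_mul_mem_two_primes_of_isSquare hp4 hq4 hpq hp7 hq7 hsq hN hr hs hrs hprim
  · exact not_forall_mul_mem_two_primes_of_isSquare hq4 hp4 (Ne.symm hpq) hq7 hp7 hsq (hN.trans (mul_comm _ _)) hr hs hrs hprim

end Pairs

end CyclotomicFermatCMType

end Literature.AlgebraicGeometry.ComplexMultiplication
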